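import Summits.BirchSwinnertonDyer.BirchSwinnertonDyer.Theorems.PrintCf2RubinValueTwoKatzPeriodNormRigidityCore
import Summits.BirchSwinnertonDyer.BirchSwinnertonDyer.Theorems.PrintCf2SplitBadTwoKatzFrameUniquenessAtTwo
import HarnessLib

set_option linter.dupNamespace false
set_option autoImplicit false

/-!
# TWO-VARIABLE KATZ PERIOD NORM RIGIDITY — file 2 (the theorem): two solutions of de Shalit's frame `IsKatzMeasure₂`
# for ONE branch at TWO period triples have period ratios `ι⁻¹(Ω/Ω')·(Ω_p'/Ω_p)` and `ι⁻¹(δ/δ')` of norm one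

Cell `bsd-print-cf2`, width seat `bsd-line-cf2c-w3` g4, route C `PrintCf2RubinValueTwo`, `--supports stmt-BirchSwinnertonDyer-23722`. HONEST
FRAMING: Theses-free helper; THEOREMS ONLY (no `def`, no named fact, no `sorry`); nothing is closed; BSD is not proved by any of this; no summit
statement is proved by this seat.

WHY.  Road α reads the two-variable Katz–de Shalit measure `G₂` OUTSIDE its interpolation range under frames `∀ (Ω, δ, Ω_p) ∀ G₂, IsKatzMeasure₂ ι v
v̄ S κ₁ κ₂ γ₁ γ₂ λ Ω δ Ω_p G₂ → …` (asides 23721 / 23722, the research kernel R of line `value-transport`, the DECIDING child 24086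
`MainConjClauseAtSplitTwoQuad` in `∀ (Ω, δ, Ω_p)`-form).  Brick B18 (`KatzFrameUniqueness.isKatzMeasure₂_unique`, every `p`) pins `G₂` at FIXED
periods; the residual objection «(R): rescale `Ω` by `2`, keep `Ω_p`, replace `G₂` by `2^{m+j}G₂`» (LEAD cf2-p1 g13 2026-08-29T04:17Z; referee g13's
stamp on 24086, item (ii), on paper) is answered here in the kernel in NORM form: **`norm_periodRatio_eq_one`** — on B18's binder list, if `G ≠ 0`
solves the frame at `(Ω, δ, Ω_p)` and `G'` the frame of the SAME branch at `(Ω', δ', Ω_p')`, then `‖ι⁻¹(Ω/Ω')·(Ω_p'/Ω_p)‖ = 1` and `‖ι⁻¹(δ/δ')‖ =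
1`. So `(Ω, Ω_p) ↦ (Ω·x, Ω_p·ι⁻¹x)` (`KatzFramePeriodRescaling`, p591738) is, up to units, the only freedom of the period pair of a realised Katz
measure, and the valuation of every prescribed value is an invariant of the branch (file 3). PROOF: B18's split-prime line, directions and supply
(steps 1–7 of `isKatzMeasure₂_unique`, verbatim, any `p`) read through ALL `t ≥ 1`; on the `s`-th monomial line the two frames prescribe node values
`y_t = c_s·D_s^t·x_t`, `D_s = A^{NW(a_s+1)}·B^{NW}` (file 1 §1), so `D_s` is a principal unit on every line with a non-zero node (file 1 §2); two
such lines give `‖A‖ = ‖B‖ = 1`; if at most one line carried a non-zero node, `G = 0` by file 1 §3 and `IntSeries.eq_zero_of_monomialLine_eq_zero`.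
NOT CLAIMED: the off-range statement at the frame point (`G' = unit·G`); see this seat's memo on crux 23722. presearch: one-variable node rigidity =
`CycTangentCMCycTangentBoundPeriodRigidity` (p592643) / `IntSeriesValueNormRigidity` (p592583), crux 22628; two-variable general-twist any-`p`: not
in the tree; print: de Shalit II.4.12 Remarks (iii)–(iv) (p. 66–67).

References: [deShalit1987] II.4.12 Remarks (iii)–(iv) (p. 66–67), II.4.16 (49)–(50), II.4.17 (52)–(54) (p. 77–78), II.6.4 (p. 85); [Katz1978]
(5.3.0); [Washington1997] §5.1–§5.2, §13.
-/

noncomputable section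

open scoped NumberField Classical Topology
open Filter NumberField IsDedekindDomain Field
open Literature Literature.NumberTheory.GaloisRepresentations Literature.NumberTheory.EllipticCurves
open Summit.BirchSwinnertonDyer.Rank1Residual.X11b Summit.BirchSwinnertonDyer.Rank1Residual.X11b.LambdaSupply
  Summit.BirchSwinnertonDyer.Rank1Residual.X11b.Three.LambdaSupply Summit.BirchSwinnertonDyer.BirchSwinnertonDyer.Theorems.PrintCf2
  Summit.BirchSwinnertonDyer.BirchSwinnertonDyer.Theorems.CycTangentCMCycTangentBoundUniquenessLines
  Summit.BirchSwinnertonDyer.BirchSwinnertonDyer.Theorems.CycTangentCMCycTangentBoundInterpolationContinuation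
  Summit.BirchSwinnertonDyer.BirchSwinnertonDyer.Theorems.CycTangentCMCycTangentBoundFrameUniqueness
  Summit.BirchSwinnertonDyer.BirchSwinnertonDyer.Theorems.CycTangentCMCycTangentBoundFrameUniquenessCM

namespace Summit.BirchSwinnertonDyer.BirchSwinnertonDyer.Theorems.PrintCf2.KatzPeriodRigidity

variable {p : ℕ} [Fact p.Prime] {K : Type} [Field K] [NumberField K]

/-! ### The theorem: the period ratio of two frames of one branch has norm one -/

/-- **TWO-VARIABLE KATZ PERIOD NORM RIGIDITY (every prime `p`, general twist).** `K` imaginary quadratic carrying a Hecke character `η` of type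
`(w₀, 0)`, `w₀ > 0`; `p = v v̄` split, `ι` inducing `v`; twist `λ` of type `(−a, b)`, `b ≤ a`, unramified off `S ∪ {v̄}`; ANY generator pair (the
binders of B18 `KatzFrameUniqueness.isKatzMeasure₂_unique`). If `G` solves `IsKatzMeasure₂ ι v v̄ S κ₁ κ₂ γ₁ γ₂ λ Ω δ Ω_p` and `G'` solves the frame
of the SAME branch at a second period triple `(Ω', δ', Ω_p')` (six non-zero period quantities) and `G ≠ 0`, then `‖ι⁻¹(Ω/Ω')·(Ω_p'/Ω_p)‖ = 1` and
`‖ι⁻¹(δ/δ')‖ = 1`. Steps 1–7 are B18's (split-prime line, conjugation, directions, `φ_s`), verbatim; step 8 reads the supply through all `t ≥ 1` and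
compares the node values of the two frames along each monomial line. [cite: deShalit1987, II.4.12 Remarks (iii)–(iv) (p. 66–67), II.4.16 (49)–(50)
(p. 76–77), II.4.17 (52)–(54) (p. 77–78)] [cite: Washington1997, §5.1–§5.2 and §13] -/
theorem norm_periodRatio_eq_one (hK : IsImaginaryQuadratic K)
    {ι : PadicAlgCl p ≃+* ℂ} {v vbar : HeightOneSpectrum (𝓞 K)}
    (hv : ((p : ℕ) : 𝓞 K) ∈ v.asIdeal) (hvbar : ((p : ℕ) : 𝓞 K) ∈ vbar.asIdeal) (hne : vbar ≠ v)
    (hι : ∀ (w : InfinitePlace K) (d : 𝓞 K), d ∈ v.asIdeal ↔ ‖ι.symm (w.embedding (d : K))‖ < 1)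
    {S : Finset (HeightOneSpectrum (𝓞 K))}
    {η : HeckeCharacter K} {w₀ : ℕ} (hw₀ : 0 < w₀) (hη : η.HasInfinityType (fun _ ↦ (w₀ : ℤ)) (fun _ ↦ 0))
    {lam : HeckeCharacter K} {a b : ℕ} (hba : b ≤ a)
    (hlam : lam.HasInfinityType (fun _ ↦ -(a : ℤ)) (fun _ ↦ (b : ℤ)))
    (hlamu : ∀ w : HeightOneSpectrum (𝓞 K), w ∉ S → w ≠ vbar → lam.IsUnramifiedAt w)
    {κ₁ κ₂ : ZpExtension K p} {γ₁ γ₂ : absoluteGaloisGroup K}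
    (hpair : ZpExtension.IsTopGeneratorPair κ₁ κ₂ γ₁ γ₂)
    {Ω δ Ω' δ' : ℂ} {Ωp Ωp' : ℂ_[p]} {G G' : PowerSeries (PowerSeries (PadicComplexInt p))}
    (hG : IsKatzMeasure₂ ι v vbar S κ₁ κ₂ γ₁ γ₂ lam Ω δ Ωp G)
    (hG' : IsKatzMeasure₂ ι v vbar S κ₁ κ₂ γ₁ γ₂ lam Ω' δ' Ωp' G')
    (hΩ : Ω ≠ 0) (hδ : δ ≠ 0) (hΩp : Ωp ≠ 0) (hΩ' : Ω' ≠ 0) (hδ' : δ' ≠ 0) (hΩp' : Ωp' ≠ 0)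
    (hG0 : G ≠ 0) :
    ‖(((ι.symm (Ω / Ω')) : PadicAlgCl p) : ℂ_[p]) * (Ωp' / Ωp)‖ = 1 ∧
      ‖(((ι.symm (δ / δ')) : PadicAlgCl p) : ℂ_[p])‖ = 1 := by
  haveI : Algebra.IsQuadraticExtension ℚ K := ⟨hK.1⟩
  haveI : IsGalois ℚ K := inferInstance
  haveI : IsCMField K := hK.isCMField
  haveI : IsTotallyComplex K := hK.2
  have himag : ∀ w : InfinitePlace K, w.IsComplex := fun w ↦ hK.2.isComplex w
  have hp : p.Prime := Fact.out
  set e := (FramedRep.unitsContinuousMulEquivOfUnique (Fin 1) (PadicAlgCl p) :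
    (PadicAlgCl p)ˣ →ₜ* GL (Fin 1) (PadicAlgCl p)) with he
  -- Step 1: `Ψ₁ = η^{-N₀}`, type `(-N, 0)` with `N = w₀ N₀`, unramified everywhere
  obtain ⟨N₁, hN₁, hηN⟩ := exists_pow_forall_isUnramifiedAt η
  set N : ℕ := N₁ * w₀ with hNdef
  have hN : 0 < N := Nat.mul_pos hN₁ hw₀
  set Ψ₁ : HeckeCharacter K := (η ^ N₁)⁻¹ with hΨ₁
  have hΨ₁t : Ψ₁.HasInfinityType (fun _ ↦ -(N : ℤ)) (fun _ ↦ 0) := by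
    have h := (HasInfinityType.pow_nat hη N₁).inv
    convert h using 2 <;> simp [hNdef]
  have hΨ₁a : Ψ₁.IsAlgebraic :=
    (HeckeCharacter.isAlgebraic_iff_exists_hasInfinityType _).mpr ⟨_, _, hΨ₁t⟩
  have hΨ₁u : ∀ w : HeightOneSpectrum (𝓞 K), Ψ₁.IsUnramifiedAt w := fun w ↦ (hηN w).inv'
  have hΨ₁pow_t : ∀ n : ℕ, (Ψ₁ ^ n).HasInfinityType (fun _ ↦ -((N * n : ℕ) : ℤ)) (fun _ ↦ 0) := by
    intro n
    have h := HasInfinityType.pow_nat hΨ₁t n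
    convert h using 2 <;> push_cast <;> ring
  have hΨ₁pow_u : ∀ (n : ℕ) (w : HeightOneSpectrum (𝓞 K)), (Ψ₁ ^ n).IsUnramifiedAt w :=
    fun n w ↦ isUnramifiedAt_pow' (hΨ₁u w) n
  -- Step 2: avatars of the powers of `Ψ₁` through the pair, tamed
  obtain ⟨M, χ₀, hM, hall⟩ := CycTangentCMCycTangentBoundPairSupply.exists_isPAdicAvatarOf_pow_factorsThroughPair
    ι hK.1 himag hΨ₁a (fun w _ ↦ hΨ₁u w) hpair
  obtain ⟨N₀, hN₀, hsmall₀⟩ := exists_pow_norm_sub_one_lt χ₀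
  set χ₁ : absoluteGaloisGroup K →ₜ* (PadicAlgCl p)ˣ := χ₀ ^ N₀ with hχ₁
  set W : ℕ := M * N₀ with hW
  have hWpos : 0 < W := Nat.mul_pos hM hN₀
  have havatar : ∀ n : ℕ, IsPAdicAvatarOf ι (Ψ₁ ^ (W * n)) (e.comp (χ₁ ^ n)) := by
    intro n
    have h := (hall (N₀ * n)).1
    rw [hχ₁, ← pow_mul, hW, mul_assoc]
    exact h
  have hpair_n : ∀ n : ℕ, FactorsThroughPair κ₁ κ₂ (e.comp (χ₁ ^ n)) := by
    intro n
    rw [hχ₁, ← pow_mul]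
    exact (hall (N₀ * n)).2
  have hsmall : ∀ (n : ℕ) (σ : absoluteGaloisGroup K),
      ‖avatarValueAt (e.comp (χ₁ ^ n)) σ - 1‖ < ‖(p : ℂ_[p])‖ := by
    intro n σ
    rw [he, avatarValueAt_unitsChar_pow]
    exact (UnrUnits.norm_pow_sub_one_le (norm_avatarValueAt_eq_one _ σ).le n).trans_lt (hsmall₀ σ)
  -- Step 3: the split-prime line `κ` carrying `χ₁`
  obtain ⟨κ, hκpair, hκinert, hsat⟩ := SplitPrimeLine.exists_splitPrimeLine_factorsThroughZp_of_split hK ι hv hvbar hne hι hpair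
  have hχ₁κ' : FactorsThroughZp κ (e.comp χ₁) := by
    have h := hsat (Ψ₁ ^ (W * 1)) (-((N * (W * 1) : ℕ) : ℤ)) ∅ (e.comp (χ₁ ^ 1)) (hΨ₁pow_t _)
      (fun w _ ↦ hΨ₁pow_u _ w) (hΨ₁pow_u _ vbar) (havatar 1) (hpair_n 1) (hsmall 1)
    rwa [pow_one] at h
  have hχ₁κ : ∀ σ, κ σ = 1 → χ₁ σ = 1 := (factorsThroughZp_unitsChar_iff κ χ₁).mp hχ₁κ'
  set γ : absoluteGaloisGroup K := κ.lift 1 with hγdef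
  have hγ : κ.IsTopGenerator γ := κ.apply_lift 1
  -- Step 4: complex conjugation, its outer action `θ`
  obtain ⟨c, hc, hc2⟩ := exists_not_mem_range_absGaloisRestrict (K := ℚ) (L := K) (Rat.castHom ℝ) himag
  set θ := absGaloisOuterConj ℚ K c with hθ
  have hθθ : ∀ σ, θ (θ σ) = σ := fun σ ↦ by
    rw [hθ, ← absGaloisOuterConj_mul_apply, hc2, absGaloisOuterConj_one_apply]
  have hθres : ∀ σ, absGaloisRestrict ℚ K (θ σ) = c * absGaloisRestrict ℚ K σ * c⁻¹ :=
    fun σ ↦ absGaloisRestrict_absGaloisOuterConj ℚ K c σ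
  -- Step 5: non-degeneracy of the directions of `κ`, `κ ∘ θ`
  have hNW : (-((N * (W * 1) : ℕ) : ℤ)) ≠ 0 := by
    have : 0 < N * (W * 1) := Nat.mul_pos hN (by omega)
    omega
  have havatar1 : IsPAdicAvatarOf ι (Ψ₁ ^ (W * 1)) (e.comp χ₁) := by
    have h := havatar 1; rwa [pow_one] at h
  have hdet := toAdd_mul_ne_of_isPAdicAvatarOf ι hK hv hvbar hne hι hpair hκinert hNW (hΨ₁pow_t _)
    (hΨ₁pow_u _) havatar1 hχ₁κ hc
  set d₁ := Multiplicative.toAdd (κ γ₁) with hd₁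
  set d₂ := Multiplicative.toAdd (κ γ₂) with hd₂
  set d₁' := Multiplicative.toAdd (κ (θ γ₁)) with hd₁'
  set d₂' := Multiplicative.toAdd (κ (θ γ₂)) with hd₂'
  -- Step 6: the lines
  have hlines := fun s : ℕ ↦ exists_line_of_direction (p := p) hK hpair hκpair hγ θ hθθ (s + 1)
  choose κL γL hκLpair hγL hκLval hκLchar using hlines
  -- at most one line has `κ_s(γ₂) = 0`: shift past it
  have hval2 : ∀ s, Multiplicative.toAdd (κL s γ₂) = ((p * (s + 1) : ℕ) : ℤ_[p]) * d₂ - d₂' :=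
    fun s ↦ hκLval s γ₂
  have hval1 : ∀ s, Multiplicative.toAdd (κL s γ₁) = ((p * (s + 1) : ℕ) : ℤ_[p]) * d₁ - d₁' :=
    fun s ↦ hκLval s γ₁
  have huniq : ∀ s t, Multiplicative.toAdd (κL s γ₂) = 0 → Multiplicative.toAdd (κL t γ₂) = 0 → s = t := by
    intro s t hs ht
    rw [hval2] at hs ht
    by_contra hst
    have hd2 : d₂ = 0 := by
      have h1 : (((p * (s + 1) : ℕ) : ℤ_[p]) - ((p * (t + 1) : ℕ) : ℤ_[p])) * d₂ = 0 := by
        linear_combination hs - ht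
      rcases mul_eq_zero.mp h1 with h | h
      · exfalso
        have : ((p * (s + 1) : ℕ) : ℤ_[p]) = ((p * (t + 1) : ℕ) : ℤ_[p]) := sub_eq_zero.mp h
        have h2 : p * (s + 1) = p * (t + 1) := by exact_mod_cast this
        have := Nat.eq_of_mul_eq_mul_left hp.pos h2
        omega
      · exact h
    have hd2' : d₂' = 0 := by rw [hd2, mul_zero, zero_sub, neg_eq_zero] at hs; exact hs
    apply hdet
    rw [hd2, hd2', mul_zero, zero_mul]
  obtain ⟨shift, hshift⟩ : ∃ shift : ℕ, ∀ s, Multiplicative.toAdd (κL (s + shift) γ₂) ≠ 0 := by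
    by_cases hbad : ∃ s₀, Multiplicative.toAdd (κL s₀ γ₂) = 0
    · obtain ⟨s₀, hs₀⟩ := hbad
      refine ⟨s₀ + 1, fun s hs ↦ ?_⟩
      have := huniq _ _ hs hs₀
      omega
    · push Not at hbad
      exact ⟨0, fun s ↦ hbad _⟩
  -- the final family
  set κF : ℕ → ZpExtension K p := fun s ↦ κL (s + shift) with hκF
  set γF : ℕ → absoluteGaloisGroup K := fun s ↦ γL (s + shift) with hγF
  set aF : ℕ → ℕ := fun s ↦ p * (s + shift + 1) with haF
  have haFpos : ∀ s, 0 < aF s := fun s ↦ Nat.mul_pos hp.pos (Nat.succ_pos _)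
  have hprop : ∀ s t, s ≠ t → Multiplicative.toAdd (κF s γ₁) * Multiplicative.toAdd (κF t γ₂) ≠
      Multiplicative.toAdd (κF t γ₁) * Multiplicative.toAdd (κF s γ₂) := by
    intro s t hst heq
    simp only [hκF, hval1, hval2] at heq
    have key : (((p * (s + shift + 1) : ℕ) : ℤ_[p]) - ((p * (t + shift + 1) : ℕ) : ℤ_[p])) *
        (d₁' * d₂ - d₁ * d₂') = 0 := by
      linear_combination heq
    rcases mul_eq_zero.mp key with h | h
    · have : ((p * (s + shift + 1) : ℕ) : ℤ_[p]) = ((p * (t + shift + 1) : ℕ) : ℤ_[p]) := sub_eq_zero.mp h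
      have h2 : p * (s + shift + 1) = p * (t + shift + 1) := by exact_mod_cast this
      have := Nat.eq_of_mul_eq_mul_left hp.pos h2
      omega
    · exact hdet (by linear_combination -h)
  -- Step 7: the characters `φ_s = χ₁^{a_s} (χ₁∘θ)⁻¹` through `κF s`
  set φ : ℕ → (absoluteGaloisGroup K →ₜ* (PadicAlgCl p)ˣ) :=
    fun s ↦ χ₁ ^ (aF s) * (χ₁.comp θ)⁻¹ with hφdef
  have hφκ : ∀ s, FactorsThroughZp (κF s) (e.comp (φ s)) := fun s ↦
    (factorsThroughZp_unitsChar_iff (κF s) (φ s)).mpr (hκLchar (s + shift) χ₁ hχ₁κ)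
  have hφpow : ∀ s n, (φ s) ^ n = χ₁ ^ (aF s * n) * ((χ₁ ^ n).comp θ)⁻¹ := by
    intro s n
    refine ContinuousMonoidHom.ext fun σ ↦ ?_
    simp only [hφdef, ContinuousMonoidHom.pow_apply, ContinuousMonoidHom.mul_apply, unitsChar_inv_apply,
      ContinuousMonoidHom.coe_comp, Function.comp_apply, mul_pow, inv_pow, pow_mul]
  -- small values of `φ_s`
  have hφsmall : ∀ s σ, ‖avatarValueAt (e.comp (φ s)) σ - 1‖ < ‖(p : ℂ_[p])‖ := by
    intro s σ
    have h1 := hsmall (aF s) σ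
    have h2 := hsmall 1 (θ σ)
    rw [pow_one] at h2
    rw [hφdef, he, avatarValueAt_unitsChar_mul, ← he]
    have e3 : avatarValueAt (e.comp (χ₁.comp θ)⁻¹) σ = (avatarValueAt (e.comp χ₁) (θ σ))⁻¹ := by
      rw [he, avatarValueAt_unitsChar, avatarValueAt_unitsChar, unitsChar_inv_apply,
        ContinuousMonoidHom.coe_comp, Function.comp_apply, Units.val_inv_eq_inv_val, PadicComplex.coe_eq,
        PadicComplex.coe_eq, map_inv₀]
    rw [e3]
    exact norm_mul_inv_sub_one_lt (norm_avatarValueAt_eq_one _ _) h1 h2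
  -- `φ_s(γ_s)` is a principal unit, not `1`
  have hφne : ∀ s, avatarValueAt (e.comp (φ s)) (γF s) ≠ 1 := by
    intro s h1
    -- then `φ_s ≡ 1`
    have hall1 : ∀ σ, avatarValueAt (e.comp (φ s)) σ = 1 := fun σ ↦ by
      rw [ZpExtension.avatarValueAt_eq_onePlusPow (hφκ s) (hγL (s + shift)) σ, h1, sub_self]
      have h := IntSeries.norm_onePlusPow_sub_one_le (Multiplicative.toAdd (κF s σ)) (x := (0 : ℂ_[p]))
        (by rw [norm_zero]; exact one_pos)
      rw [norm_zero] at h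
      exact sub_eq_zero.mp (norm_le_zero_iff.mp h)
    -- hence `χ₁` kills `θ(I_𝔓)` for `𝔓 ∣ v̄`: `e∘χ₁` unramified at `v`
    have hχθ : ∀ 𝔓 ∈ vbar.primesAbove, ∀ τ ∈ 𝔓.inertia (absoluteGaloisGroup K), χ₁ (θ τ) = 1 := by
      intro 𝔓 h𝔓 τ hτ
      have hκτ : κ τ = 1 := ZpExtension.mem_kerSubgroup.mp (hκinert 𝔓 h𝔓 hτ)
      have hχτ : χ₁ τ = 1 := hχ₁κ τ hκτ
      have h := hall1 τ
      rw [he, avatarValueAt_unitsChar, hφdef, ContinuousMonoidHom.mul_apply, ContinuousMonoidHom.pow_apply,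
        hχτ, one_pow, one_mul, unitsChar_inv_apply, ContinuousMonoidHom.coe_comp, Function.comp_apply,
        ← UniformSpace.Completion.coe_one, UniformSpace.Completion.coe_inj] at h
      exact inv_eq_one.mp (Units.ext h)
    have hunrθ : (FramedGaloisRep.outerConj c (e.comp χ₁)).IsUnramifiedAt vbar := by
      intro 𝔓 h𝔓 τ hτ
      rw [FramedGaloisRep.outerConj_apply, ← hθ, ContinuousMonoidHom.coe_comp, Function.comp_apply,
        hχθ 𝔓 h𝔓 τ hτ, map_one]
    have hcbar : absGaloisQuot ℚ K c ≠ 1 := fun h1 ↦ by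
      obtain ⟨x, hx⟩ := (absGaloisQuot_eq_one_iff ℚ K c).1 h1
      exact hc ⟨x, hx⟩
    have hunrv : FramedGaloisRep.IsUnramifiedAt v (e.comp χ₁) := by
      have h := (FramedGaloisRep.isUnramifiedAt_outerConj_iff c (e.comp χ₁) vbar).mp hunrθ
      rwa [CycTangentCMCycTangentBoundAvatarRamified.smul_eq_of_ne_one hK.1 hv hvbar hne hcbar] at h
    exact CycTangentCMCycTangentBoundAvatarRamified.not_isUnramifiedAt_avatar_of_hasInfinityType_ne_zero ι hK
      hv hvbar hne hι hNW (hΨ₁pow_t _) (T := ∅) (fun w _ ↦ hΨ₁pow_u _ w) (hΨ₁pow_u _ v) havatar1 hunrv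
  -- Step 8 (this file): the supply through ALL `t ≥ 1`, indexed by `t + 1`
  set ρ : ℕ → ℕ → HeckeCharacter K := fun s t ↦
    Ψ₁ ^ (W * (aF s * (t + 1))) * (HeckeCharacter.galConj (IsCMField.complexConj K) (Ψ₁ ^ (W * (t + 1))))⁻¹
    with hρdef
  set r : ℕ → ℕ → FramedGaloisRep K (PadicAlgCl p) 1 := fun s t ↦ e.comp ((φ s) ^ (t + 1)) with hrdef
  set m : ℕ → ℕ → ℕ := fun s t ↦ a + N * (W * (aF s * (t + 1))) with hmdef
  set j : ℕ → ℕ → ℕ := fun s t ↦ b + N * (W * (t + 1)) with hjdef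
  have hr : ∀ s t, IsPAdicAvatarOf ι (ρ s t) (r s t) := by
    intro s t
    have h1 : IsPAdicAvatarOf ι (Ψ₁ ^ (W * (aF s * (t + 1)))) (e.comp (χ₁ ^ (aF s * (t + 1)))) := havatar _
    have h2 : IsPAdicAvatarOf ι (HeckeCharacter.galConj (IsCMField.complexConj K) (Ψ₁ ^ (W * (t + 1))))
        (e.comp ((χ₁ ^ (t + 1)).comp θ)) := by
      have h := isPAdicAvatarOf_galConj_complexConj_comp hK.1 ι (havatar (t + 1)) hc hθres
      exact h
    have h3 := isPAdicAvatarOf_mul ι h1 (isPAdicAvatarOf_inv ι h2)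
      (hram_of_forall (fun w _ ↦ hΨ₁pow_u _ w) (fun w _ ↦ ?_))
    · rw [hrdef, hρdef]
      simp only
      rw [hφpow s (t + 1)]
      exact h3
    · rw [← inv_inv (HeckeCharacter.galConj _ _)]
      refine HeckeCharacter.IsUnramifiedAt.inv' ?_
      rw [inv_inv, HeckeCharacter.isUnramifiedAt_galConj_iff]
      exact hΨ₁pow_u _ _
  have hκr : ∀ s t, FactorsThroughZp (κF s) (r s t) := fun s t ↦ factorsThroughZp_unitsChar_pow _ (hφκ s) _
  have haF2 : ∀ s, 2 ≤ aF s := fun s ↦ by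
    have h2 : 2 ≤ p := hp.two_le
    show 2 ≤ p * (s + shift + 1)
    nlinarith
  have hjm : ∀ s t, j s t < m s t := by
    intro s t
    have h1 : 2 * (W * (t + 1)) ≤ W * (aF s * (t + 1)) := by
      have := Nat.mul_le_mul_left (W * (t + 1)) (haF2 s)
      nlinarith
    have h2 : N * (2 * (W * (t + 1))) ≤ N * (W * (aF s * (t + 1))) := Nat.mul_le_mul_left _ h1
    have h3 : 0 < N * (W * (t + 1)) := Nat.mul_pos hN (Nat.mul_pos hWpos (Nat.succ_pos t))
    show b + N * (W * (t + 1)) < a + N * (W * (aF s * (t + 1)))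
    nlinarith
  have hinf : ∀ s t, (lam * ρ s t).HasInfinityType (fun _ ↦ -(m s t : ℤ)) (fun _ ↦ (j s t : ℤ)) := by
    intro s t
    have h := hlam.mul' ((hΨ₁pow_t (W * (aF s * (t + 1)))).mul'
      ((hΨ₁pow_t (W * (t + 1))).galConj_complexConj.inv))
    show (lam * (Ψ₁ ^ (W * (aF s * (t + 1))) *
        (HeckeCharacter.galConj (IsCMField.complexConj K) (Ψ₁ ^ (W * (t + 1))))⁻¹)).HasInfinityType
      (fun _ ↦ -((a + N * (W * (aF s * (t + 1))) : ℕ) : ℤ)) (fun _ ↦ ((b + N * (W * (t + 1)) : ℕ) : ℤ))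
    convert h using 2 <;> simp only [Pi.add_apply, Pi.neg_apply] <;> push_cast <;> ring
  have hunr : ∀ s t (w : HeightOneSpectrum (𝓞 K)), w ∉ S → w ≠ vbar → (lam * ρ s t).IsUnramifiedAt w := by
    intro s t w hw hwv
    refine (hlamu w hw hwv).mul' ((hΨ₁pow_u _ w).mul' ?_)
    rw [← inv_inv (HeckeCharacter.galConj _ _)]
    refine HeckeCharacter.IsUnramifiedAt.inv' ?_
    rw [inv_inv, HeckeCharacter.isUnramifiedAt_galConj_iff]
    exact hΨ₁pow_u _ _
  have hL : ∀ s t, LFunction.HasEntireContinuation (heckeLFunction (lam * ρ s t)) :=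
    fun s t ↦ hasEntireContinuation_of_hasInfinityType hK (hjm s t) (hinf s t)
  set u : ℕ → ℂ_[p] := fun s ↦ avatarValueAt (e.comp (φ s)) (γF s) with hudef
  have hrval : ∀ s t, avatarValueAt (r s t) (γF s) = u s ^ (t + 1) :=
    fun s t ↦ by rw [hrdef, hudef, he, avatarValueAt_unitsChar_pow]
  have hp1 : ‖(p : ℂ_[p])‖ ≤ 1 := norm_prime_padicComplex_lt_one.le
  have husmall : ∀ s, ‖u s - 1‖ < ‖(p : ℂ_[p])‖ := fun s ↦ hφsmall s (γF s)
  have hu1 : ∀ s, ‖u s - 1‖ < 1 := fun s ↦ (husmall s).trans_le hp1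
  have hune : ∀ s, u s ≠ 1 := fun s ↦ hφne s
  set F : ℕ → PowerSeries (PadicComplexInt p) := fun s ↦
    IntSeries.monomialLine (Multiplicative.toAdd (κF s γ₁)) (Multiplicative.toAdd (κF s γ₂)) G with hFdef
  set F' : ℕ → PowerSeries (PadicComplexInt p) := fun s ↦
    IntSeries.monomialLine (Multiplicative.toAdd (κF s γ₁)) (Multiplicative.toAdd (κF s γ₂)) G' with hF'def
  have hFbr : ∀ s, DeShalit1987.IsKatzBranch ι v vbar S (κF s) (γF s) lam Ω δ Ωp (F s) :=
    fun s ↦ hG.isKatzBranch_monomialLine (hκLpair _) (hγL _)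
  have hF'br : ∀ s, DeShalit1987.IsKatzBranch ι v vbar S (κF s) (γF s) lam Ω' δ' Ωp' (F' s) :=
    fun s ↦ hG'.isKatzBranch_monomialLine (hκLpair _) (hγL _)
  set x : ℕ → ℕ → ℂ_[p] := fun s t ↦
    (((ι.symm (DeShalit1987.interpolationValue p v vbar S (lam * ρ s t) (m s t) (j s t) Ω δ
      ((hL s t).continuation 0))) : PadicAlgCl p) : ℂ_[p]) * Ωp ^ (m s t + j s t) with hxdef
  set y : ℕ → ℕ → ℂ_[p] := fun s t ↦
    (((ι.symm (DeShalit1987.interpolationValue p v vbar S (lam * ρ s t) (m s t) (j s t) Ω' δ'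
      ((hL s t).continuation 0))) : PadicAlgCl p) : ℂ_[p]) * Ωp' ^ (m s t + j s t) with hydef
  have hxF : ∀ s t, IntSeries.HasValueAt (F s) (u s ^ (t + 1) - 1) (x s t) := fun s t ↦ by
    rw [← hrval s t]
    exact hFbr s (ρ s t) (r s t) (m s t) (j s t) (hr s t) (hκr s t) (hjm s t) (hinf s t) (hunr s t) (hL s t)
  have hyF : ∀ s t, IntSeries.HasValueAt (F' s) (u s ^ (t + 1) - 1) (y s t) := fun s t ↦ by
    rw [← hrval s t]
    exact hF'br s (ρ s t) (r s t) (m s t) (j s t) (hr s t) (hκr s t) (hjm s t) (hinf s t) (hunr s t) (hL s t)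
  set A : ℂ_[p] := (((ι.symm (Ω / Ω')) : PadicAlgCl p) : ℂ_[p]) * (Ωp' / Ωp) with hAdef
  set B : ℂ_[p] := (((ι.symm (δ / δ')) : PadicAlgCl p) : ℂ_[p]) with hBdef
  have hιne : ∀ z : ℂ, z ≠ 0 → (((ι.symm z) : PadicAlgCl p) : ℂ_[p]) ≠ 0 := fun z hz ↦ by
    rw [PadicComplex.coe_eq, map_ne_zero_iff _ (algebraMap (PadicAlgCl p) ℂ_[p]).injective,
      map_ne_zero_iff _ ι.symm.injective]
    exact hz
  have hA0 : A ≠ 0 := mul_ne_zero (hιne _ (div_ne_zero hΩ hΩ')) (div_ne_zero hΩp' hΩp)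
  have hB0 : B ≠ 0 := hιne _ (div_ne_zero hδ hδ')
  set c : ℕ → ℂ_[p] := fun s ↦ A ^ (a + b + N * (W * (aF s + 1))) * B ^ (b + N * W) with hcdef
  set D : ℕ → ℂ_[p] := fun s ↦ A ^ (N * (W * (aF s + 1))) * B ^ (N * W) with hDdef
  have hc0 : ∀ s, c s ≠ 0 := fun s ↦ mul_ne_zero (pow_ne_zero _ hA0) (pow_ne_zero _ hB0)
  have hD0 : ∀ s, D s ≠ 0 := fun s ↦ mul_ne_zero (pow_ne_zero _ hA0) (pow_ne_zero _ hB0)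
  have hxy : ∀ s t, y s t = c s * D s ^ t * x s t := by
    intro s t
    rw [hydef, hxdef]
    simp only
    rw [padicValue_eq_periodRatio_pow_mul ι v vbar S _ (m s t) (j s t) Ω' δ' _ Ωp' hΩ hδ hΩp, ← hAdef, ← hBdef,
      hmdef, hjdef]
    simp only
    rw [hcdef, hDdef]
    ring
  have hunit : ∀ s t₀, x s t₀ ≠ 0 → ‖D s - 1‖ < 1 := fun s t₀ h0 ↦
    norm_sub_one_lt_one_of_values_mul_pow_succ (F s) (F' s) (hu1 s) (hc0 s) (hD0 s) (hxF s) (hyF s) (hxy s) h0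
  have hzero : ∀ s, (∀ t, x s t = 0) → F s = 0 := fun s hs ↦
    eq_zero_of_hasValueAt_nodes_zero (F s) (hune s) (husmall s) fun t ↦ by simpa only [hs t] using hxF s t
  have hGzero : ∀ c₀ : ℕ, (∀ s, F (s + c₀) = 0) → G = 0 := by
    intro c₀ hF0
    refine IntSeries.eq_zero_of_monomialLine_eq_zero G (fun s ↦ Multiplicative.toAdd (κF (s + c₀) γ₁))
      (fun s ↦ Multiplicative.toAdd (κF (s + c₀) γ₂)) (fun s ↦ hshift _) (fun s t hst ↦ hprop _ _ (by omega))
      fun s ↦ ?_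
    have h := hF0 s
    rwa [hFdef] at h
  by_cases htwo : ∃ s s' t t', s ≠ s' ∧ x s t ≠ 0 ∧ x s' t' ≠ 0
  · obtain ⟨s, s', t, t', hss', hst, hs't'⟩ := htwo
    have hexp : N * (W * (aF s + 1)) ≠ N * (W * (aF s' + 1)) := by
      intro h
      have h4 := Nat.eq_of_mul_eq_mul_left hN h
      have h5 := Nat.eq_of_mul_eq_mul_left hWpos h4
      have h6 : aF s = aF s' := by omega
      simp only [haF] at h6
      have h7 := Nat.eq_of_mul_eq_mul_left hp.pos h6
      omega
    exact norm_eq_one_of_two_principal_monomials hA0 hB0 hexp (Nat.mul_pos hN hWpos).ne' (hunit s t hst)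
      (hunit s' t' hs't')
  · exfalso
    apply hG0
    push Not at htwo
    by_cases hbad : ∃ s₁ t₁, x s₁ t₁ ≠ 0
    · obtain ⟨s₁, t₁, h₁⟩ := hbad
      refine hGzero (s₁ + 1) fun s ↦ hzero _ fun t ↦ ?_
      by_contra hst
      exact h₁ (htwo (s + (s₁ + 1)) s₁ t t₁ (by omega) hst)
    · push Not at hbad
      exact hGzero 0 fun s ↦ hzero _ fun t ↦ hbad _ _



end Summit.BirchSwinnertonDyer.BirchSwinnertonDyer.Theorems.PrintCf2.KatzPeriodRigidity

end
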